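import Literature.NumberTheory.LFunctions.SelbergDeltaDensityInput
import HarnessLib

/-!
# The density input, asymptotic form: `∑_{T/2<γ≤5T/2} m(ρ) δ_ρ e^{τδ_ρ/4} ≤ c_near · T`

Topic `Literature/NumberTheory/LFunctions`. Everything in this file is PROVED (no definitions, no
named facts).

We specialise the explicit bound `nearSum_le_explicit` (`SelbergDeltaDensityInput.lean`) to the
parameters `X = T^{1/60}` (mollifier length), `V = T^{19/20}` (Gaussian window),
`ε = T^{-1/40}` (the free parameter of Lemma 9.23), `M'' = 1200` (`τ ≤ log T/1200`), feed it the
Gaussian critical-line mean square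
(`Literature.NumberTheory.LFunctions.TwistedMoment.meanSquare_zetaMollifierG_half_le`), and verify the
elementary numerics for `T ≥ 10^{1000}`: the result is `nearSum_le_linear`, the `O(T)` bound for the
off-line input of the `L¹` theory of `S(t+h) − S(t)` with a constant independent of `τ` (hence of
the shift `h`), which is what makes Selberg's choice of a large shift scale possible.

## References

* A. Selberg, *Contributions to the theory of the Riemann zeta-function* (1946), Thm. 1, §§5–7.
* E. C. Titchmarsh, *The Theory of the Riemann Zeta-Function*, 2nd ed. (1986), Thm. 9.19 (C),
  §9.26. [cite: Titchmarsh1986, §9.26]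
-/

noncomputable section

open Complex Real MeasureTheory Set Filter Finset

namespace Literature.NumberTheory.LFunctions.SelbergDelta

open Literature.NumberTheory.LFunctions.TwistedMoment
open Literature.NumberTheory.LFunctions.ZeroOrdinateSums

/-! ### Elementary numerics for `T ≥ 10^{1000}` -/

/-- `T = T^a · T^b` for `a + b = 1`, `T > 0`. [folklore] -/
theorem rpow_split {T a b : ℝ} (hT : 0 < T) (hab : a + b = 1) : T = T ^ a * T ^ b := by
  rw [← Real.rpow_add hT, hab, Real.rpow_one]

/-- `log 25 ≤ 4`, `log 10 ≤ 3`, `log 4 ≤ 2`, `log 3 ≤ 2`. [folklore] -/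
theorem log_consts : Real.log 25 ≤ 4 ∧ Real.log 10 ≤ 3 ∧ Real.log 4 ≤ 2 ∧ Real.log 3 ≤ 2 := by
  have he := Real.exp_one_gt_d9
  have h27 : (2.7 : ℝ) ≤ Real.exp 1 := by linarith
  have p2 := pow_le_pow_left₀ (by norm_num : (0:ℝ) ≤ 2.7) h27 2
  have p3 := pow_le_pow_left₀ (by norm_num : (0:ℝ) ≤ 2.7) h27 3
  have p4 := pow_le_pow_left₀ (by norm_num : (0:ℝ) ≤ 2.7) h27 4
  have h2 : Real.exp 2 = Real.exp 1 ^ 2 := by rw [← Real.exp_nat_mul]; norm_num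
  have h3 : Real.exp 3 = Real.exp 1 ^ 3 := by rw [← Real.exp_nat_mul]; norm_num
  have h4 : Real.exp 4 = Real.exp 1 ^ 4 := by rw [← Real.exp_nat_mul]; norm_num
  refine ⟨?_, ?_, ?_, ?_⟩
  · rw [Real.log_le_iff_le_exp (by norm_num), h4]; norm_num at p4; linarith
  · rw [Real.log_le_iff_le_exp (by norm_num), h3]; norm_num at p3; linarith
  · rw [Real.log_le_iff_le_exp (by norm_num), h2]; norm_num at p2; linarith
  · rw [Real.log_le_iff_le_exp (by norm_num), h2]; norm_num at p2; linarith

/-- From `10^{1000} ≤ T`: `10^k ≤ T^s` whenever `k ≤ 1000 s` (`s > 0`). [folklore] -/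
theorem pow_ten_le_rpow {T s : ℝ} {k : ℕ} (hT : (10 : ℝ) ^ (1000 : ℕ) ≤ T) (hs : 0 < s) (hk : (k : ℝ) ≤ 1000 * s) :
    (10 : ℝ) ^ k ≤ T ^ s := by
  have hT0 : 0 < T := lt_of_lt_of_le (by positivity) hT
  calc (10 : ℝ) ^ k = (10 : ℝ) ^ (k : ℝ) := (Real.rpow_natCast 10 k).symm
    _ ≤ (10 : ℝ) ^ (1000 * s) := Real.rpow_le_rpow_of_exponent_le (by norm_num) hk
    _ = ((10 : ℝ) ^ (1000 : ℕ)) ^ s := by rw [← Real.rpow_natCast 10 1000, ← Real.rpow_mul (by norm_num)]; norm_num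
    _ ≤ T ^ s := Real.rpow_le_rpow (by positivity) hT hs.le

/-- `1 ≤ T` and `0 < T` from the threshold. [folklore] -/
theorem one_le_of_threshold {T : ℝ} (hT : (10 : ℝ) ^ (1000 : ℕ) ≤ T) : 1 ≤ T ∧ 0 < T := by
  have h : (1 : ℝ) ≤ (10 : ℝ) ^ (1000 : ℕ) := one_le_pow₀ (by norm_num)
  exact ⟨h.trans hT, lt_of_lt_of_le (by positivity) hT⟩

/-- `2000 ≤ log T` from the threshold (`log 10 > 2`). [folklore] -/
theorem log_ge_of_threshold {T : ℝ} (hT : (10 : ℝ) ^ (1000 : ℕ) ≤ T) : 2000 ≤ Real.log T := by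
  have h10 : (2 : ℝ) ≤ Real.log 10 := by
    rw [Real.le_log_iff_exp_le (by norm_num)]
    have := Real.exp_one_lt_d9
    have h2 : Real.exp 2 = Real.exp 1 * Real.exp 1 := by rw [← Real.exp_add]; norm_num
    rw [h2]; nlinarith [Real.exp_pos 1]
  have h1 : Real.log ((10 : ℝ) ^ (1000 : ℕ)) ≤ Real.log T := Real.log_le_log (by positivity) hT
  rw [Real.log_pow] at h1
  push_cast at h1
  linarith

/-- `1 + log(3T) ≤ (1 + 1/s)·3·T^s` for `T ≥ 1`, `0 < s ≤ 1`. [folklore] -/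
theorem one_add_log_three_mul_le {T s : ℝ} (hT : 1 ≤ T) (hs : 0 < s) (hs1 : s ≤ 1) :
    1 + Real.log (3 * T) ≤ (1 + 1 / s) * 3 * T ^ s := by
  have h3T : 1 ≤ 3 * T := by linarith
  have h1 := Real.log_le_rpow_div (by linarith : (0:ℝ) ≤ 3 * T) hs
  have h2 : 1 ≤ (3 * T) ^ s := Real.one_le_rpow h3T hs.le
  have h3 : (3 * T) ^ s ≤ 3 * T ^ s := by
    rw [Real.mul_rpow (by norm_num) (by linarith)]
    refine mul_le_mul_of_nonneg_right ?_ (by positivity)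
    calc (3 : ℝ) ^ s ≤ (3 : ℝ) ^ (1 : ℝ) := Real.rpow_le_rpow_of_exponent_le (by norm_num) hs1
      _ = 3 := Real.rpow_one 3
  have hs' : 0 ≤ 1 + 1 / s := by positivity
  calc 1 + Real.log (3 * T) ≤ (3 * T) ^ s + (3 * T) ^ s / s := by linarith
    _ = (1 + 1 / s) * (3 * T) ^ s := by ring
    _ ≤ (1 + 1 / s) * (3 * T ^ s) := mul_le_mul_of_nonneg_left h3 hs'
    _ = _ := by ring

/-- `e^{-x} ≤ (k/x)^k` for `x > 0`, `k ≥ 1`. [folklore] -/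
theorem exp_neg_le_div_pow {x : ℝ} (hx : 0 < x) {k : ℕ} (hk : 1 ≤ k) : Real.exp (-x) ≤ ((k : ℝ) / x) ^ k := by
  have hk0 : (0 : ℝ) < k := by exact_mod_cast hk
  have h1 : x / k ≤ Real.exp (x / k) := by have := Real.add_one_le_exp (x / k); linarith
  have h2 : (x / k) ^ k ≤ Real.exp x := by
    calc (x / k) ^ k ≤ (Real.exp (x / k)) ^ k := pow_le_pow_left₀ (by positivity) h1 k
      _ = Real.exp x := by rw [← Real.exp_nat_mul]; congr 1; field_simp
  have hpos : 0 < (x / k) ^ k := by positivity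
  rw [Real.exp_neg]
  calc (Real.exp x)⁻¹ ≤ ((x / k) ^ k)⁻¹ := inv_anti₀ hpos h2
    _ = ((k : ℝ) / x) ^ k := by rw [← inv_pow, inv_div]

/-! ### The specific numeric facts (`X = T^{1/60}`, `V = T^{19/20}`, `ε = T^{-1/40}`) -/

section numerics

variable {T : ℝ} (hT : (10 : ℝ) ^ (1000 : ℕ) ≤ T)
include hT

/-- `100 ≤ X`. [folklore] -/
theorem numX : 100 ≤ T ^ (1 / 60 : ℝ) := by
  have := pow_ten_le_rpow (k := 2) hT (by norm_num : (0:ℝ) < 1 / 60) (by norm_num); norm_num at this; exact this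

/-- `10 ≤ T^{1/240}`… in the form `10^k ≤ T^s` used below we call `pow_ten_le_rpow` directly. `5 ≤ V`. [folklore] -/
theorem numV : 10 ≤ T ^ (19 / 20 : ℝ) := by
  have := pow_ten_le_rpow (k := 1) hT (by norm_num : (0:ℝ) < 19 / 20) (by norm_num); norm_num at this; exact this

/-- `V ≤ T/8` (indeed `10 V ≤ T`). [folklore] -/
theorem numVT : 10 * T ^ (19 / 20 : ℝ) ≤ T := by
  have hT0 := (one_le_of_threshold hT).2
  have h1 : (10 : ℝ) ≤ T ^ (1 / 20 : ℝ) := by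
    have := pow_ten_le_rpow (k := 1) hT (by norm_num : (0:ℝ) < 1 / 20) (by norm_num); norm_num at this; exact this
  have e : T = T ^ (1 / 20 : ℝ) * T ^ (19 / 20 : ℝ) := rpow_split hT0 (by norm_num)
  have h0 : 0 ≤ T ^ (19 / 20 : ℝ) := by positivity
  calc 10 * T ^ (19 / 20 : ℝ) ≤ T ^ (1 / 20 : ℝ) * T ^ (19 / 20 : ℝ) := mul_le_mul_of_nonneg_right h1 h0
    _ = T := e.symm

/-- `5 X ≤ √(T/(8π))`. [folklore] -/
theorem numXsqrt : 5 * T ^ (1 / 60 : ℝ) ≤ Real.sqrt (T / (8 * π)) := by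
  have hT0 := (one_le_of_threshold hT).2
  have h1 : (100 : ℝ) ≤ T ^ (29 / 60 : ℝ) := by
    have := pow_ten_le_rpow (k := 2) hT (by norm_num : (0:ℝ) < 29 / 60) (by norm_num); norm_num at this; exact this
  clear hT
  have hsqrt : Real.sqrt T = T ^ (1 / 60 : ℝ) * T ^ (29 / 60 : ℝ) := by
    rw [Real.sqrt_eq_rpow, ← Real.rpow_add hT0]; norm_num
  have h8π : Real.sqrt (T / (8 * π)) ≥ Real.sqrt T / 6 := by
    rw [ge_iff_le, div_le_iff₀ (by norm_num : (0:ℝ) < 6), ← Real.sqrt_mul_self (by norm_num : (0:ℝ) ≤ 6),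
      ← Real.sqrt_mul (by positivity)]
    refine Real.sqrt_le_sqrt ?_
    rw [div_mul_eq_mul_div, le_div_iff₀ (by positivity)]
    have h8 : 8 * π < 36 := by linarith [Real.pi_lt_d2]
    nlinarith [mul_lt_mul_of_pos_left h8 hT0]
  have hX0 : 0 ≤ T ^ (1 / 60 : ℝ) := by positivity
  calc 5 * T ^ (1 / 60 : ℝ) ≤ T ^ (1 / 60 : ℝ) * T ^ (29 / 60 : ℝ) / 6 := by
        rw [le_div_iff₀ (by norm_num)]; nlinarith
    _ = Real.sqrt T / 6 := by rw [hsqrt]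
    _ ≤ _ := h8π

/-- `log(3T)/log X ≤ 61`. [folklore] -/
theorem numLogRatio : Real.log (3 * T) / Real.log (T ^ (1 / 60 : ℝ)) ≤ 61 := by
  have ⟨hT1, hT0⟩ := one_le_of_threshold hT
  have hL := log_ge_of_threshold hT
  clear hT
  rw [Real.log_rpow hT0, Real.log_mul (by norm_num) hT0.ne']
  have h3 := log_consts.2.2.2
  rw [div_le_iff₀ (by positivity)]
  nlinarith

/-- (a) `X (3T)^{9/10} ≤ V`. [folklore] -/
theorem numEa : T ^ (1 / 60 : ℝ) * (3 * T) ^ (9 / 10 : ℝ) ≤ T ^ (19 / 20 : ℝ) := by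
  have ⟨hT1, hT0⟩ := one_le_of_threshold hT
  have h3 : (3 * T) ^ (9 / 10 : ℝ) ≤ 3 * T ^ (9 / 10 : ℝ) := by
    rw [Real.mul_rpow (by norm_num) hT0.le]
    refine mul_le_mul_of_nonneg_right ?_ (by positivity)
    calc (3 : ℝ) ^ (9 / 10 : ℝ) ≤ (3 : ℝ) ^ (1 : ℝ) := Real.rpow_le_rpow_of_exponent_le (by norm_num) (by norm_num)
      _ = 3 := Real.rpow_one 3
  have h10 : (10 : ℝ) ≤ T ^ (1 / 30 : ℝ) := by
    have := pow_ten_le_rpow (k := 1) hT (by norm_num : (0:ℝ) < 1 / 30) (by norm_num); norm_num at this; exact this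
  have e1 : T ^ (1 / 60 : ℝ) * T ^ (9 / 10 : ℝ) = T ^ (55 / 60 : ℝ) := by rw [← Real.rpow_add hT0]; norm_num
  have e2 : T ^ (19 / 20 : ℝ) = T ^ (1 / 30 : ℝ) * T ^ (55 / 60 : ℝ) := by rw [← Real.rpow_add hT0]; norm_num
  have h0 : 0 ≤ T ^ (55 / 60 : ℝ) := by positivity
  calc T ^ (1 / 60 : ℝ) * (3 * T) ^ (9 / 10 : ℝ) ≤ T ^ (1 / 60 : ℝ) * (3 * T ^ (9 / 10 : ℝ)) :=
        mul_le_mul_of_nonneg_left h3 (by positivity)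
    _ = 3 * T ^ (55 / 60 : ℝ) := by rw [← e1]; ring
    _ ≤ T ^ (1 / 30 : ℝ) * T ^ (55 / 60 : ℝ) := mul_le_mul_of_nonneg_right (by linarith) h0
    _ = _ := e2.symm

/-- (b) `X · X^{3/2} (3T)^{1/2} (1 + log 3T)² ≤ V`. [folklore] -/
theorem numEb : T ^ (1 / 60 : ℝ) * ((T ^ (1 / 60 : ℝ)) ^ (3 / 2 : ℝ) * Real.sqrt (3 * T) * (1 + Real.log (3 * T)) ^ 2) ≤
    T ^ (19 / 20 : ℝ) := by
  have ⟨hT1, hT0⟩ := one_le_of_threshold hT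
  have hX32 : (T ^ (1 / 60 : ℝ)) ^ (3 / 2 : ℝ) = T ^ (1 / 40 : ℝ) := by rw [← Real.rpow_mul hT0.le]; norm_num
  have hsq : Real.sqrt (3 * T) ≤ 2 * T ^ (1 / 2 : ℝ) := by
    rw [Real.sqrt_eq_rpow, Real.mul_rpow (by norm_num) hT0.le]
    refine mul_le_mul_of_nonneg_right ?_ (by positivity)
    rw [show (3 : ℝ) ^ (1 / 2 : ℝ) = Real.sqrt 3 by rw [Real.sqrt_eq_rpow]]
    rw [Real.sqrt_le_left (by norm_num)]; norm_num
  have hlog : 1 + Real.log (3 * T) ≤ 33 * T ^ (1 / 10 : ℝ) := by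
    have := one_add_log_three_mul_le hT1 (by norm_num : (0:ℝ) < 1 / 10) (by norm_num); norm_num at this; linarith
  have h3T : (1:ℝ) ≤ 3 * T := by clear hT hX32 hsq hlog; linarith
  have hlog0 : 0 ≤ 1 + Real.log (3 * T) := by have := Real.log_nonneg h3T; clear hT; linarith
  have hlog2 : (1 + Real.log (3 * T)) ^ 2 ≤ 1089 * T ^ (1 / 5 : ℝ) := by
    calc (1 + Real.log (3 * T)) ^ 2 ≤ (33 * T ^ (1 / 10 : ℝ)) ^ 2 := pow_le_pow_left₀ hlog0 hlog 2
      _ = 1089 * (T ^ (1 / 10 : ℝ)) ^ 2 := by ring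
      _ = 1089 * T ^ (1 / 5 : ℝ) := by rw [← Real.rpow_natCast, ← Real.rpow_mul hT0.le]; norm_num
  have h10 : (10 : ℝ) ^ 4 ≤ T ^ (5 / 24 : ℝ) := pow_ten_le_rpow hT (by norm_num) (by norm_num)
  have e1 : T ^ (1 / 60 : ℝ) * T ^ (1 / 40 : ℝ) * T ^ (1 / 2 : ℝ) * T ^ (1 / 5 : ℝ) = T ^ (89 / 120 : ℝ) := by
    rw [← Real.rpow_add hT0, ← Real.rpow_add hT0, ← Real.rpow_add hT0]; norm_num
  have e2 : T ^ (19 / 20 : ℝ) = T ^ (5 / 24 : ℝ) * T ^ (89 / 120 : ℝ) := by rw [← Real.rpow_add hT0]; norm_num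
  have hpos : 0 ≤ T ^ (89 / 120 : ℝ) := by positivity
  rw [hX32]
  calc T ^ (1 / 60 : ℝ) * (T ^ (1 / 40 : ℝ) * Real.sqrt (3 * T) * (1 + Real.log (3 * T)) ^ 2)
      ≤ T ^ (1 / 60 : ℝ) * (T ^ (1 / 40 : ℝ) * (2 * T ^ (1 / 2 : ℝ)) * (1089 * T ^ (1 / 5 : ℝ))) := by
        refine mul_le_mul_of_nonneg_left ?_ (by positivity)
        exact mul_le_mul (mul_le_mul_of_nonneg_left hsq (by positivity)) hlog2 (by positivity) (by positivity)
    _ = 2178 * T ^ (89 / 120 : ℝ) := by rw [← e1]; ring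
    _ ≤ T ^ (5 / 24 : ℝ) * T ^ (89 / 120 : ℝ) := mul_le_mul_of_nonneg_right (le_trans (by norm_num) h10) hpos
    _ = _ := e2.symm

/-- (c) `X · X^{1/2} V² (2/T) ≤ V`. [folklore] -/
theorem numEc : T ^ (1 / 60 : ℝ) * (Real.sqrt (T ^ (1 / 60 : ℝ)) * (T ^ (19 / 20 : ℝ)) ^ 2 * (2 / T)) ≤ T ^ (19 / 20 : ℝ) := by
  have ⟨hT1, hT0⟩ := one_le_of_threshold hT
  have hsX : Real.sqrt (T ^ (1 / 60 : ℝ)) = T ^ (1 / 120 : ℝ) := by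
    rw [Real.sqrt_eq_rpow, ← Real.rpow_mul hT0.le]; norm_num
  have hV2 : (T ^ (19 / 20 : ℝ)) ^ 2 * (2 / T) = 2 * T ^ (9 / 10 : ℝ) := by
    rw [← Real.rpow_natCast, ← Real.rpow_mul hT0.le, show ((19 / 20 : ℝ) * (2 : ℕ)) = 9 / 10 + 1 by norm_num,
      Real.rpow_add hT0, Real.rpow_one]; field_simp
  have h10 : (10 : ℝ) ≤ T ^ (1 / 40 : ℝ) := by
    have := pow_ten_le_rpow (k := 1) hT (by norm_num : (0:ℝ) < 1 / 40) (by norm_num); norm_num at this; exact this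
  have e1 : T ^ (1 / 60 : ℝ) * T ^ (1 / 120 : ℝ) * T ^ (9 / 10 : ℝ) = T ^ (111 / 120 : ℝ) := by
    rw [← Real.rpow_add hT0, ← Real.rpow_add hT0]; norm_num
  have e2 : T ^ (19 / 20 : ℝ) = T ^ (1 / 40 : ℝ) * T ^ (111 / 120 : ℝ) := by rw [← Real.rpow_add hT0]; norm_num
  have hpos : 0 ≤ T ^ (111 / 120 : ℝ) := by positivity
  rw [hsX, mul_assoc (T ^ (1 / 120 : ℝ)), hV2]
  calc T ^ (1 / 60 : ℝ) * (T ^ (1 / 120 : ℝ) * (2 * T ^ (9 / 10 : ℝ))) = 2 * T ^ (111 / 120 : ℝ) := by rw [← e1]; ring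
    _ ≤ T ^ (1 / 40 : ℝ) * T ^ (111 / 120 : ℝ) := mul_le_mul_of_nonneg_right (by linarith) hpos
    _ = _ := e2.symm

/-- (d) `X · X V (2/T)^{1/2} ≤ V`. [folklore] -/
theorem numEd : T ^ (1 / 60 : ℝ) * (T ^ (1 / 60 : ℝ) * T ^ (19 / 20 : ℝ) * Real.sqrt (2 / T)) ≤ T ^ (19 / 20 : ℝ) := by
  have ⟨hT1, hT0⟩ := one_le_of_threshold hT
  have hs : Real.sqrt (2 / T) ≤ 2 * T ^ (-(1 / 2) : ℝ) := by
    rw [Real.sqrt_eq_rpow, Real.div_rpow (by norm_num) hT0.le, Real.rpow_neg hT0.le, div_eq_mul_inv]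
    refine mul_le_mul_of_nonneg_right ?_ (by positivity)
    rw [show (2 : ℝ) ^ (1 / 2 : ℝ) = Real.sqrt 2 by rw [Real.sqrt_eq_rpow]]
    rw [Real.sqrt_le_left (by norm_num)]; norm_num
  have h2 : (2 : ℝ) ≤ T ^ (7 / 15 : ℝ) := by
    have := pow_ten_le_rpow (k := 1) hT (by norm_num : (0:ℝ) < 7 / 15) (by norm_num); norm_num at this; linarith
  have e1 : T ^ (1 / 60 : ℝ) * T ^ (1 / 60 : ℝ) * T ^ (19 / 20 : ℝ) * T ^ (-(1 / 2) : ℝ) = T ^ (29 / 60 : ℝ) := by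
    rw [← Real.rpow_add hT0, ← Real.rpow_add hT0, ← Real.rpow_add hT0]; norm_num
  have e2 : T ^ (19 / 20 : ℝ) = T ^ (7 / 15 : ℝ) * T ^ (29 / 60 : ℝ) := by rw [← Real.rpow_add hT0]; norm_num
  have hpos : 0 ≤ T ^ (29 / 60 : ℝ) := by positivity
  calc T ^ (1 / 60 : ℝ) * (T ^ (1 / 60 : ℝ) * T ^ (19 / 20 : ℝ) * Real.sqrt (2 / T))
      ≤ T ^ (1 / 60 : ℝ) * (T ^ (1 / 60 : ℝ) * T ^ (19 / 20 : ℝ) * (2 * T ^ (-(1 / 2) : ℝ))) := by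
        refine mul_le_mul_of_nonneg_left (mul_le_mul_of_nonneg_left hs (by positivity)) (by positivity)
    _ = 2 * T ^ (29 / 60 : ℝ) := by rw [← e1]; ring
    _ ≤ T ^ (7 / 15 : ℝ) * T ^ (29 / 60 : ℝ) := mul_le_mul_of_nonneg_right h2 hpos
    _ = _ := e2.symm

/-- (e) `X ε V (1 + log 3T) ≤ V` (`ε = T^{-1/40}`). [folklore] -/
theorem numEe : T ^ (1 / 60 : ℝ) * (T ^ (-(1 / 40) : ℝ) * T ^ (19 / 20 : ℝ) * (1 + Real.log (3 * T))) ≤ T ^ (19 / 20 : ℝ) := by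
  have ⟨hT1, hT0⟩ := one_le_of_threshold hT
  have hlog : 1 + Real.log (3 * T) ≤ 723 * T ^ (1 / 240 : ℝ) := by
    have := one_add_log_three_mul_le hT1 (by norm_num : (0:ℝ) < 1 / 240) (by norm_num); norm_num at this; linarith
  have h10 : (10 : ℝ) ^ 3 ≤ T ^ (1 / 240 : ℝ) := pow_ten_le_rpow hT (by norm_num) (by norm_num)
  have e1 : T ^ (1 / 60 : ℝ) * T ^ (-(1 / 40) : ℝ) * T ^ (19 / 20 : ℝ) * T ^ (1 / 240 : ℝ) = T ^ (227 / 240 : ℝ) := by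
    rw [← Real.rpow_add hT0, ← Real.rpow_add hT0, ← Real.rpow_add hT0]; norm_num
  have e2 : T ^ (19 / 20 : ℝ) = T ^ (1 / 240 : ℝ) * T ^ (227 / 240 : ℝ) := by rw [← Real.rpow_add hT0]; norm_num
  have hpos : 0 ≤ T ^ (227 / 240 : ℝ) := by positivity
  calc T ^ (1 / 60 : ℝ) * (T ^ (-(1 / 40) : ℝ) * T ^ (19 / 20 : ℝ) * (1 + Real.log (3 * T)))
      ≤ T ^ (1 / 60 : ℝ) * (T ^ (-(1 / 40) : ℝ) * T ^ (19 / 20 : ℝ) * (723 * T ^ (1 / 240 : ℝ))) :=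
        mul_le_mul_of_nonneg_left (mul_le_mul_of_nonneg_left hlog (by positivity)) (by positivity)
    _ = 723 * T ^ (227 / 240 : ℝ) := by rw [← e1]; ring
    _ ≤ T ^ (1 / 240 : ℝ) * T ^ (227 / 240 : ℝ) := mul_le_mul_of_nonneg_right (le_trans (by norm_num) h10) hpos
    _ = _ := e2.symm

/-- (f) `X ε⁻¹ (1 + V (2/T)^{1/2} + V² (2/T)) ≤ V`. [folklore] -/
theorem numEf : T ^ (1 / 60 : ℝ) * ((T ^ (-(1 / 40) : ℝ))⁻¹ *
    (1 + T ^ (19 / 20 : ℝ) * Real.sqrt (2 / T) + (T ^ (19 / 20 : ℝ)) ^ 2 * (2 / T))) ≤ T ^ (19 / 20 : ℝ) := by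
  have ⟨hT1, hT0⟩ := one_le_of_threshold hT
  have hεi : (T ^ (-(1 / 40) : ℝ))⁻¹ = T ^ (1 / 40 : ℝ) := by rw [Real.rpow_neg hT0.le, inv_inv]
  have hV2 : (T ^ (19 / 20 : ℝ)) ^ 2 * (2 / T) = 2 * T ^ (9 / 10 : ℝ) := by
    rw [← Real.rpow_natCast, ← Real.rpow_mul hT0.le, show ((19 / 20 : ℝ) * (2 : ℕ)) = 9 / 10 + 1 by norm_num,
      Real.rpow_add hT0, Real.rpow_one]; field_simp
  have hVs : T ^ (19 / 20 : ℝ) * Real.sqrt (2 / T) ≤ 2 * T ^ (9 / 10 : ℝ) := by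
    have hs : Real.sqrt (2 / T) ≤ 2 * T ^ (-(1 / 2) : ℝ) := by
      rw [Real.sqrt_eq_rpow, Real.div_rpow (by norm_num) hT0.le, Real.rpow_neg hT0.le, div_eq_mul_inv]
      refine mul_le_mul_of_nonneg_right ?_ (by positivity)
      rw [show (2 : ℝ) ^ (1 / 2 : ℝ) = Real.sqrt 2 by rw [Real.sqrt_eq_rpow]]
      rw [Real.sqrt_le_left (by norm_num)]; norm_num
    have e : T ^ (19 / 20 : ℝ) * T ^ (-(1 / 2) : ℝ) = T ^ (9 / 20 : ℝ) := by rw [← Real.rpow_add hT0]; norm_num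
    calc T ^ (19 / 20 : ℝ) * Real.sqrt (2 / T) ≤ T ^ (19 / 20 : ℝ) * (2 * T ^ (-(1 / 2) : ℝ)) :=
          mul_le_mul_of_nonneg_left hs (by positivity)
      _ = 2 * T ^ (9 / 20 : ℝ) := by rw [← e]; ring
      _ ≤ 2 * T ^ (9 / 10 : ℝ) := by
          refine mul_le_mul_of_nonneg_left (Real.rpow_le_rpow_of_exponent_le hT1 (by norm_num)) (by norm_num)
  have h1 : (1 : ℝ) ≤ T ^ (9 / 10 : ℝ) := Real.one_le_rpow hT1 (by norm_num)
  have hsum : 1 + T ^ (19 / 20 : ℝ) * Real.sqrt (2 / T) + (T ^ (19 / 20 : ℝ)) ^ 2 * (2 / T) ≤ 5 * T ^ (9 / 10 : ℝ) := by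
    rw [hV2]; linarith
  have h10 : (10 : ℝ) ≤ T ^ (1 / 120 : ℝ) := by
    have := pow_ten_le_rpow (k := 1) hT (by norm_num : (0:ℝ) < 1 / 120) (by norm_num); norm_num at this; exact this
  have e1 : T ^ (1 / 60 : ℝ) * T ^ (1 / 40 : ℝ) * T ^ (9 / 10 : ℝ) = T ^ (113 / 120 : ℝ) := by
    rw [← Real.rpow_add hT0, ← Real.rpow_add hT0]; norm_num
  have e2 : T ^ (19 / 20 : ℝ) = T ^ (1 / 120 : ℝ) * T ^ (113 / 120 : ℝ) := by rw [← Real.rpow_add hT0]; norm_num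
  have hpos : 0 ≤ T ^ (113 / 120 : ℝ) := by positivity
  rw [hεi]
  calc T ^ (1 / 60 : ℝ) * (T ^ (1 / 40 : ℝ) * (1 + T ^ (19 / 20 : ℝ) * Real.sqrt (2 / T) + (T ^ (19 / 20 : ℝ)) ^ 2 * (2 / T)))
      ≤ T ^ (1 / 60 : ℝ) * (T ^ (1 / 40 : ℝ) * (5 * T ^ (9 / 10 : ℝ))) :=
        mul_le_mul_of_nonneg_left (mul_le_mul_of_nonneg_left hsum (by positivity)) (by positivity)
    _ = 5 * T ^ (113 / 120 : ℝ) := by rw [← e1]; ring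
    _ ≤ T ^ (1 / 120 : ℝ) * T ^ (113 / 120 : ℝ) := mul_le_mul_of_nonneg_right (by linarith) hpos
    _ = _ := e2.symm

set_option exponentiation.threshold 400 in
/-- (g) `X (1+V)⁷ e^{-(T/(8V))²} ≤ V`. [folklore] -/
theorem numEg : T ^ (1 / 60 : ℝ) * (1 + T ^ (19 / 20 : ℝ)) ^ 7 * Real.exp (-(T / (8 * T ^ (19 / 20 : ℝ))) ^ 2) ≤
    T ^ (19 / 20 : ℝ) := by
  have ⟨hT1, hT0⟩ := one_le_of_threshold hT
  have hV1 : (1 : ℝ) ≤ T ^ (19 / 20 : ℝ) := Real.one_le_rpow hT1 (by norm_num)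
  -- `(T/(8V))² = T^{1/10}/64`
  have hx : (T / (8 * T ^ (19 / 20 : ℝ))) ^ 2 = T ^ (1 / 10 : ℝ) / 64 := by
    have e : T / T ^ (19 / 20 : ℝ) = T ^ (1 / 20 : ℝ) := by
      rw [div_eq_iff (by positivity), ← Real.rpow_add hT0]; norm_num
    rw [show T / (8 * T ^ (19 / 20 : ℝ)) = (T / T ^ (19 / 20 : ℝ)) / 8 by field_simp, e, div_pow,
      ← Real.rpow_natCast, ← Real.rpow_mul hT0.le]; norm_num
  have hxpos : 0 < T ^ (1 / 10 : ℝ) / 64 := by positivity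
  have hexp : Real.exp (-(T / (8 * T ^ (19 / 20 : ℝ))) ^ 2) ≤ (4480 : ℝ) ^ 70 * T ^ (-(7 : ℝ)) := by
    rw [hx]
    refine (exp_neg_le_div_pow hxpos (k := 70) (by norm_num)).trans (le_of_eq ?_)
    have e1 : ((70 : ℕ) : ℝ) / (T ^ (1 / 10 : ℝ) / 64) = 4480 * T ^ (-(1 / 10) : ℝ) := by
      rw [Real.rpow_neg hT0.le]; field_simp; norm_num
    have e2 : (T ^ (-(1 / 10) : ℝ)) ^ 70 = T ^ (-(7 : ℝ)) := by
      rw [← Real.rpow_natCast, ← Real.rpow_mul hT0.le]; norm_num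
    rw [e1, mul_pow, e2]
  have hpow : (1 + T ^ (19 / 20 : ℝ)) ^ 7 ≤ 128 * T ^ (133 / 20 : ℝ) := by
    calc (1 + T ^ (19 / 20 : ℝ)) ^ 7 ≤ (2 * T ^ (19 / 20 : ℝ)) ^ 7 := pow_le_pow_left₀ (by positivity) (by linarith) 7
      _ = 128 * (T ^ (19 / 20 : ℝ)) ^ 7 := by ring
      _ = 128 * T ^ (133 / 20 : ℝ) := by rw [← Real.rpow_natCast, ← Real.rpow_mul hT0.le]; norm_num
  have e1 : T ^ (1 / 60 : ℝ) * T ^ (133 / 20 : ℝ) * T ^ (-(7 : ℝ)) = T ^ (-(1 / 3) : ℝ) := by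
    rw [← Real.rpow_add hT0, ← Real.rpow_add hT0]; norm_num
  have h10 : (10 : ℝ) ^ 258 ≤ T ^ (1 / 3 : ℝ) := pow_ten_le_rpow hT (by norm_num) (by norm_num)
  have hC : (128 : ℝ) * 4480 ^ 70 ≤ (10 : ℝ) ^ 258 := by
    have h : (128 * 4480 ^ 70 : ℕ) ≤ 10 ^ 258 := by decide
    exact_mod_cast h
  have hinv : T ^ (-(1 / 3) : ℝ) * T ^ (1 / 3 : ℝ) = 1 := by rw [← Real.rpow_add hT0]; norm_num
  calc T ^ (1 / 60 : ℝ) * (1 + T ^ (19 / 20 : ℝ)) ^ 7 * Real.exp (-(T / (8 * T ^ (19 / 20 : ℝ))) ^ 2)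
      ≤ T ^ (1 / 60 : ℝ) * (128 * T ^ (133 / 20 : ℝ)) * ((4480 : ℝ) ^ 70 * T ^ (-(7 : ℝ))) :=
        mul_le_mul (mul_le_mul_of_nonneg_left hpow (by positivity)) hexp (Real.exp_pos _).le (by positivity)
    _ = (128 * 4480 ^ 70) * T ^ (-(1 / 3) : ℝ) := by rw [← e1]; ring
    _ ≤ T ^ (1 / 3 : ℝ) * T ^ (-(1 / 3) : ℝ) := mul_le_mul_of_nonneg_right (hC.trans h10) (by positivity)
    _ = 1 := by rw [mul_comm, hinv]
    _ ≤ T ^ (19 / 20 : ℝ) := hV1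

/-- `(2T+3) log(5T/2+3) ≤ 3 T log T`. [folklore] -/
theorem numN0 : (2 * T + 3) * Real.log (5 * T / 2 + 3) ≤ 3 * T * Real.log T := by
  have ⟨hT1, hT0⟩ := one_le_of_threshold hT
  have hL := log_ge_of_threshold hT
  have hT10 := pow_ten_le_rpow (k := 1) hT (by norm_num : (0:ℝ) < 1) (by norm_num)
  clear hT
  rw [Real.rpow_one] at hT10; norm_num at hT10
  have hT6 : (6 : ℝ) ≤ T := by linarith
  have h1 : Real.log (5 * T / 2 + 3) ≤ Real.log 3 + Real.log T := by
    rw [← Real.log_mul (by norm_num) hT0.ne']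
    exact Real.log_le_log (by positivity) (by linarith)
  have h3 := log_consts.2.2.2
  have hlog0 : 0 ≤ Real.log (5 * T / 2 + 3) := Real.log_nonneg (by linarith)
  nlinarith

/-- The lower-order block terms: `R · L · e^{(⌊L/2⌋+1)/4800} ≤ V`,
`R = 8 V X^{-1/2} + 5π(15(log 10 + 4 log(3T+13) + log X) + 1) + 5π/2`. [folklore] -/
theorem numR : (8 * T ^ (19 / 20 : ℝ) * (T ^ (1 / 60 : ℝ)) ^ (-(1 / 2 : ℝ)) +
      5 * (π * (15 * (Real.log 10 + 4 * Real.log (3 * T + 13) + Real.log (T ^ (1 / 60 : ℝ))) + 1)) + 5 / 2 * π) *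
    (Real.log T * Real.exp (((⌊Real.log T / 2⌋₊ : ℝ) + 1) / (4 * 1200))) ≤ T ^ (19 / 20 : ℝ) := by
  have ⟨hT1, hT0⟩ := one_le_of_threshold hT
  have hL := log_ge_of_threshold hT
  have hT1a : (10 : ℝ) ^ 4 ≤ T ^ (1 / 240 : ℝ) := pow_ten_le_rpow hT (by norm_num) (by norm_num)
  have hT1b : (10 : ℝ) ^ 6 ≤ T ^ (7199 / 9600 : ℝ) := pow_ten_le_rpow hT (by norm_num) (by norm_num)
  have hTbig : (10 : ℝ) ^ 3 ≤ T ^ (1 : ℝ) := pow_ten_le_rpow hT (by norm_num) (by norm_num)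
  rw [Real.rpow_one] at hTbig
  norm_num at hTbig
  clear hT
  set Lg := Real.log T with hLdef
  set V := T ^ (19 / 20 : ℝ) with hV
  have hV0 : 0 < V := by positivity
  obtain ⟨-, h10, h4, -⟩ := log_consts
  -- `R ≤ 8 V T^{-1/120} + 1600 Lg`
  have hXm : (T ^ (1 / 60 : ℝ)) ^ (-(1 / 2 : ℝ)) = T ^ (-(1 / 120) : ℝ) := by rw [← Real.rpow_mul hT0.le]; norm_num
  have hlogX : Real.log (T ^ (1 / 60 : ℝ)) = Lg / 60 := by rw [Real.log_rpow hT0]; ring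
  have hlog3T : Real.log (3 * T + 13) ≤ 2 + Lg := by
    have : Real.log (3 * T + 13) ≤ Real.log (4 * T) := Real.log_le_log (by positivity) (by linarith)
    rw [Real.log_mul (by norm_num) hT0.ne'] at this; linarith
  have hR : 8 * V * (T ^ (1 / 60 : ℝ)) ^ (-(1 / 2 : ℝ)) +
      5 * (π * (15 * (Real.log 10 + 4 * Real.log (3 * T + 13) + Real.log (T ^ (1 / 60 : ℝ))) + 1)) + 5 / 2 * π ≤
      8 * V * T ^ (-(1 / 120) : ℝ) + 1600 * Lg := by
    rw [hXm, hlogX]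
    have hπ4 : π ≤ 4 := by linarith [Real.pi_lt_d2]
    have hin : 15 * (Real.log 10 + 4 * Real.log (3 * T + 13) + Lg / 60) + 1 ≤ 76 * Lg := by nlinarith
    have hin0 : 0 ≤ 15 * (Real.log 10 + 4 * Real.log (3 * T + 13) + Lg / 60) + 1 := by
      have : 0 ≤ Real.log (3 * T + 13) := Real.log_nonneg (by linarith)
      have : 0 ≤ Real.log 10 := Real.log_nonneg (by norm_num)
      positivity
    nlinarith [Real.pi_pos, mul_le_mul hπ4 hin hin0 (by norm_num)]
  -- `e^{(⌊Lg/2⌋+1)/4800} ≤ 2 T^{1/9600}`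
  have hE : Real.exp (((⌊Lg / 2⌋₊ : ℝ) + 1) / (4 * 1200)) ≤ 2 * T ^ (1 / 9600 : ℝ) := by
    have hfl : (⌊Lg / 2⌋₊ : ℝ) ≤ Lg / 2 := Nat.floor_le (by linarith)
    have h1 : Real.exp (((⌊Lg / 2⌋₊ : ℝ) + 1) / (4 * 1200)) ≤ Real.exp (1 / 4800 + Lg / 9600) :=
      Real.exp_le_exp.2 (by rw [div_le_iff₀ (by norm_num)]; linarith)
    rw [Real.exp_add] at h1
    have h2 : Real.exp (1 / 4800) ≤ 2 := by
      have := Real.abs_exp_sub_one_le (x := 1 / 4800) (by rw [abs_of_pos (by norm_num)]; norm_num)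
      rw [abs_of_pos (by norm_num : (0:ℝ) < 1 / 4800)] at this
      have := (abs_le.1 this).2
      linarith
    have h3 : Real.exp (Lg / 9600) = T ^ (1 / 9600 : ℝ) := by
      rw [Real.rpow_def_of_pos hT0, hLdef]; ring_nf
    rw [h3] at h1
    exact h1.trans (mul_le_mul_of_nonneg_right h2 (by positivity))
  -- the two terms
  have hLa : Lg ≤ 247 * T ^ (39 / 9600 : ℝ) := by
    have := Real.log_le_rpow_div hT0.le (by norm_num : (0:ℝ) < 39 / 9600)
    rw [← hLdef] at this
    have e : T ^ (39 / 9600 : ℝ) / (39 / 9600) = (9600 / 39) * T ^ (39 / 9600 : ℝ) := by field_simp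
    rw [e] at this
    have : (9600 / 39 : ℝ) ≤ 247 := by norm_num
    nlinarith [Real.rpow_nonneg hT0.le (39 / 9600 : ℝ)]
  have hLb : Lg ≤ 10 * T ^ (1 / 10 : ℝ) := by
    have := Real.log_le_rpow_div hT0.le (by norm_num : (0:ℝ) < 1 / 10)
    rw [← hLdef] at this; linarith
  -- term 1: `16 V Lg T^{1/9600 − 1/120} ≤ V/2`
  have hterm1 : 16 * V * Lg * (T ^ (-(1 / 120) : ℝ) * T ^ (1 / 9600 : ℝ)) ≤ V / 2 := by
    have e1 : T ^ (-(1 / 120) : ℝ) * T ^ (1 / 9600 : ℝ) * T ^ (39 / 9600 : ℝ) = T ^ (-(1 / 240) : ℝ) := by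
      rw [← Real.rpow_add hT0, ← Real.rpow_add hT0]; norm_num
    have e2 : T ^ (-(1 / 240) : ℝ) * T ^ (1 / 240 : ℝ) = 1 := by rw [← Real.rpow_add hT0]; norm_num
    have hpos : 0 ≤ T ^ (-(1 / 120) : ℝ) * T ^ (1 / 9600 : ℝ) := by positivity
    calc 16 * V * Lg * (T ^ (-(1 / 120) : ℝ) * T ^ (1 / 9600 : ℝ))
        ≤ 16 * V * (247 * T ^ (39 / 9600 : ℝ)) * (T ^ (-(1 / 120) : ℝ) * T ^ (1 / 9600 : ℝ)) :=
          mul_le_mul_of_nonneg_right (mul_le_mul_of_nonneg_left hLa (by positivity)) hpos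
      _ = 3952 * V * T ^ (-(1 / 240) : ℝ) := by rw [← e1]; ring
      _ ≤ 3952 * V * T ^ (-(1 / 240) : ℝ) * (T ^ (1 / 240 : ℝ) / (10 : ℝ) ^ 4) := by
          refine le_mul_of_one_le_right (by positivity) ?_
          rw [le_div_iff₀ (by positivity), one_mul]; exact hT1a
      _ = 3952 / 10 ^ 4 * V * (T ^ (-(1 / 240) : ℝ) * T ^ (1 / 240 : ℝ)) := by ring
      _ = 3952 / 10 ^ 4 * V := by rw [e2, mul_one]
      _ ≤ V / 2 := by rw [div_mul_eq_mul_div, div_le_div_iff₀ (by positivity) (by norm_num)]; nlinarith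
  -- term 2: `3200 L² T^{1/9600} ≤ V/2`
  have hterm2 : 3200 * Lg ^ 2 * T ^ (1 / 9600 : ℝ) ≤ V / 2 := by
    have hL2 : Lg ^ 2 ≤ 100 * T ^ (1 / 5 : ℝ) := by
      calc Lg ^ 2 ≤ (10 * T ^ (1 / 10 : ℝ)) ^ 2 := pow_le_pow_left₀ (by linarith) hLb 2
        _ = 100 * (T ^ (1 / 10 : ℝ)) ^ 2 := by ring
        _ = 100 * T ^ (1 / 5 : ℝ) := by rw [← Real.rpow_natCast, ← Real.rpow_mul hT0.le]; norm_num
    have e1 : T ^ (1 / 5 : ℝ) * T ^ (1 / 9600 : ℝ) * T ^ (7199 / 9600 : ℝ) = V := by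
      rw [hV, ← Real.rpow_add hT0, ← Real.rpow_add hT0]; norm_num
    have hpos : 0 ≤ T ^ (1 / 9600 : ℝ) := by positivity
    calc 3200 * Lg ^ 2 * T ^ (1 / 9600 : ℝ) ≤ 3200 * (100 * T ^ (1 / 5 : ℝ)) * T ^ (1 / 9600 : ℝ) :=
          mul_le_mul_of_nonneg_right (mul_le_mul_of_nonneg_left hL2 (by norm_num)) hpos
      _ = 320000 * (T ^ (1 / 5 : ℝ) * T ^ (1 / 9600 : ℝ)) := by ring
      _ ≤ (T ^ (7199 / 9600 : ℝ) / 2) * (T ^ (1 / 5 : ℝ) * T ^ (1 / 9600 : ℝ)) := by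
          refine mul_le_mul_of_nonneg_right ?_ (by positivity)
          rw [le_div_iff₀ (by norm_num)]
          norm_num at hT1b ⊢
          linarith
      _ = V / 2 := by rw [← e1]; ring
  -- combine
  have hLnn : 0 ≤ Lg := by linarith
  have hEnn : 0 ≤ Real.exp (((⌊Lg / 2⌋₊ : ℝ) + 1) / (4 * 1200)) := (Real.exp_pos _).le
  have hRnn : 0 ≤ 8 * V * T ^ (-(1 / 120) : ℝ) + 1600 * Lg := by positivity
  calc _ ≤ (8 * V * T ^ (-(1 / 120) : ℝ) + 1600 * Lg) * (Lg * Real.exp (((⌊Lg / 2⌋₊ : ℝ) + 1) / (4 * 1200))) :=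
        mul_le_mul_of_nonneg_right hR (by positivity)
    _ ≤ (8 * V * T ^ (-(1 / 120) : ℝ) + 1600 * Lg) * (Lg * (2 * T ^ (1 / 9600 : ℝ))) :=
        mul_le_mul_of_nonneg_left (mul_le_mul_of_nonneg_left hE hLnn) hRnn
    _ = 16 * V * Lg * (T ^ (-(1 / 120) : ℝ) * T ^ (1 / 9600 : ℝ)) + 3200 * Lg ^ 2 * T ^ (1 / 9600 : ℝ) := by ring
    _ ≤ V / 2 + V / 2 := add_le_add hterm1 hterm2
    _ = V := by ring

end numerics

/-! ### The uniform Gaussian mean-square bound on `[T/2, 3T]` -/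

set_option maxHeartbeats 1000000 in
/-- **Uniform critical-line mean square.** With `C₅, t₅` of
`Literature.NumberTheory.LFunctions.TwistedMoment.meanSquare_zetaMollifierG_half_le`, for
`T ≥ 10^{1000}`, `T ≥ 4t₅` and every `T₀ ∈ [T/2, 3T]`:
`∫ |G_{X,T₀,V}(1/2+iy)|² dy ≤ 70 C₅ V` (`X = T^{1/60}`, `V = T^{19/20}`). [cite: Titchmarsh1986, §9.24] -/
theorem meanSquare_half_uniform {C₅ t₅ : ℝ} (hC₅ : 0 < C₅)
    (hhalf : ∀ (T₀ X V ε : ℝ), t₅ ≤ T₀ / 2 → 3 ≤ X → 4 * X ≤ (⌊Real.sqrt (T₀ / (4 * π))⌋₊ : ℝ) →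
      3 ≤ V → V ≤ T₀ / 4 → 0 < ε → ε ≤ 1 →
      ∫ y : ℝ, ‖zetaMollifierG X T₀ V ((1 / 2 : ℝ) + y * I)‖ ^ 2 ≤
        C₅ * (V * (1 + Real.log T₀ / Real.log X)
          + X * (T₀ ^ (9 / 10 : ℝ) + X ^ (3 / 2 : ℝ) * Real.sqrt T₀ * (1 + Real.log T₀) ^ 2
              + Real.sqrt X * V ^ 2 / T₀ + X * V / Real.sqrt T₀
              + ε * V * (1 + Real.log T₀) + ε⁻¹ * (1 + V / Real.sqrt T₀ + V ^ 2 / T₀))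
          + X * (1 + V) ^ 7 * Real.exp (-(T₀ / (4 * V)) ^ 2) + V))
    {T : ℝ} (hT : (10 : ℝ) ^ (1000 : ℕ) ≤ T) (ht₅ : 4 * t₅ ≤ T) {T₀ : ℝ} (h1 : T / 2 ≤ T₀) (h2 : T₀ ≤ 3 * T) :
    ∫ y : ℝ, ‖zetaMollifierG (T ^ (1 / 60 : ℝ)) T₀ (T ^ (19 / 20 : ℝ)) ((1 / 2 : ℝ) + y * I)‖ ^ 2 ≤
      70 * C₅ * T ^ (19 / 20 : ℝ) := by
  have ⟨hT1, hT0⟩ := one_le_of_threshold hT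
  have hX := numX hT
  have hV := numV hT
  have hVT := numVT hT
  have hXs := numXsqrt hT
  have hratio := numLogRatio hT
  have hEa := numEa hT
  have hEb := numEb hT
  have hEc := numEc hT
  have hEd := numEd hT
  have hEe := numEe hT
  have hEf := numEf hT
  have hEg := numEg hT
  clear hT
  have hX0 : 0 < T ^ (1 / 60 : ℝ) := by positivity
  have hV0 : 0 < T ^ (19 / 20 : ℝ) := by positivity
  have hε0 : 0 < T ^ (-(1 / 40) : ℝ) := by positivity
  have hε1 : T ^ (-(1 / 40) : ℝ) ≤ 1 := Real.rpow_le_one_of_one_le_of_nonpos hT1 (by norm_num)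
  generalize hXdef : T ^ (1 / 60 : ℝ) = X at hX hXs hratio hEa hEb hEc hEd hEe hEf hEg hX0 ⊢
  generalize hVdef : T ^ (19 / 20 : ℝ) = V at hV hVT hEa hEb hEc hEd hEe hEf hEg hV0 ⊢
  generalize hεdef : T ^ (-(1 / 40) : ℝ) = ε at hEe hEf hε0 hε1
  have hT₀0 : 0 < T₀ := by linarith
  have hT₀1 : 1 ≤ T₀ := by linarith
  -- hypotheses of the half-line lemma at `T₀`
  have hfloor : 4 * X ≤ (⌊Real.sqrt (T₀ / (4 * π))⌋₊ : ℝ) := by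
    have hmono : Real.sqrt (T / (8 * π)) ≤ Real.sqrt (T₀ / (4 * π)) := Real.sqrt_le_sqrt (by
      rw [div_le_div_iff₀ (by positivity) (by positivity)]; nlinarith [Real.pi_pos])
    have := Nat.lt_floor_add_one (Real.sqrt (T₀ / (4 * π)))
    have hX1 : (1 : ℝ) ≤ X := by linarith
    linarith
  have h := hhalf T₀ X V ε (by linarith) (by linarith) hfloor (by linarith) (by linarith) hε0 hε1
  refine h.trans ?_
  -- bound the pieces
  have hlogX : 0 < Real.log X := Real.log_pos (by linarith)
  have hlogT₀ : Real.log T₀ ≤ Real.log (3 * T) := Real.log_le_log hT₀0 h2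
  have hlogT₀0 : 0 ≤ Real.log T₀ := Real.log_nonneg hT₀1
  have p1 : V * (1 + Real.log T₀ / Real.log X) ≤ 62 * V := by
    have : Real.log T₀ / Real.log X ≤ 61 := (div_le_div_of_nonneg_right hlogT₀ hlogX.le).trans hratio
    nlinarith
  -- the six `E₀` terms, each monotone in `T₀` and then `≤ V/X`-sized
  have hinvT : 1 / T₀ ≤ 2 / T := by rw [div_le_div_iff₀ hT₀0 hT0]; linarith
  have hinvs : 1 / Real.sqrt T₀ ≤ Real.sqrt (2 / T) := by
    rw [one_div, ← Real.sqrt_inv]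
    exact Real.sqrt_le_sqrt (by rw [inv_eq_one_div]; exact hinvT)
  have m1 : T₀ ^ (9 / 10 : ℝ) ≤ (3 * T) ^ (9 / 10 : ℝ) := Real.rpow_le_rpow hT₀0.le h2 (by norm_num)
  have m2 : X ^ (3 / 2 : ℝ) * Real.sqrt T₀ * (1 + Real.log T₀) ^ 2 ≤
      X ^ (3 / 2 : ℝ) * Real.sqrt (3 * T) * (1 + Real.log (3 * T)) ^ 2 := by
    refine mul_le_mul (mul_le_mul_of_nonneg_left (Real.sqrt_le_sqrt h2) (by positivity)) ?_ (by positivity) (by positivity)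
    exact pow_le_pow_left₀ (add_nonneg zero_le_one hlogT₀0) (add_le_add le_rfl hlogT₀) 2
  have m3 : Real.sqrt X * V ^ 2 / T₀ ≤ Real.sqrt X * V ^ 2 * (2 / T) := by
    rw [div_eq_mul_one_div]; exact mul_le_mul_of_nonneg_left hinvT (by positivity)
  have m4 : X * V / Real.sqrt T₀ ≤ X * V * Real.sqrt (2 / T) := by
    rw [div_eq_mul_one_div]; exact mul_le_mul_of_nonneg_left hinvs (by positivity)
  have m5 : ε * V * (1 + Real.log T₀) ≤ ε * V * (1 + Real.log (3 * T)) :=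
    mul_le_mul_of_nonneg_left (by linarith) (by positivity)
  have m6 : ε⁻¹ * (1 + V / Real.sqrt T₀ + V ^ 2 / T₀) ≤ ε⁻¹ * (1 + V * Real.sqrt (2 / T) + V ^ 2 * (2 / T)) := by
    refine mul_le_mul_of_nonneg_left ?_ (by positivity)
    have a1 : V / Real.sqrt T₀ ≤ V * Real.sqrt (2 / T) := by
      rw [div_eq_mul_one_div]; exact mul_le_mul_of_nonneg_left hinvs hV0.le
    have a2 : V ^ 2 / T₀ ≤ V ^ 2 * (2 / T) := by
      rw [div_eq_mul_one_div]; exact mul_le_mul_of_nonneg_left hinvT (by positivity)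
    linarith
  have p2 : X * (T₀ ^ (9 / 10 : ℝ) + X ^ (3 / 2 : ℝ) * Real.sqrt T₀ * (1 + Real.log T₀) ^ 2
      + Real.sqrt X * V ^ 2 / T₀ + X * V / Real.sqrt T₀
      + ε * V * (1 + Real.log T₀) + ε⁻¹ * (1 + V / Real.sqrt T₀ + V ^ 2 / T₀)) ≤ 6 * V := by
    have hsum := add_le_add (add_le_add (add_le_add (add_le_add (add_le_add m1 m2) m3) m4) m5) m6
    have := mul_le_mul_of_nonneg_left hsum hX0.le
    refine this.trans ?_
    have e : X * ((3 * T) ^ (9 / 10 : ℝ) + X ^ (3 / 2 : ℝ) * Real.sqrt (3 * T) * (1 + Real.log (3 * T)) ^ 2 +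
        Real.sqrt X * V ^ 2 * (2 / T) + X * V * Real.sqrt (2 / T) + ε * V * (1 + Real.log (3 * T)) +
        ε⁻¹ * (1 + V * Real.sqrt (2 / T) + V ^ 2 * (2 / T))) =
        X * (3 * T) ^ (9 / 10 : ℝ) + X * (X ^ (3 / 2 : ℝ) * Real.sqrt (3 * T) * (1 + Real.log (3 * T)) ^ 2) +
        X * (Real.sqrt X * V ^ 2 * (2 / T)) + X * (X * V * Real.sqrt (2 / T)) + X * (ε * V * (1 + Real.log (3 * T))) +
        X * (ε⁻¹ * (1 + V * Real.sqrt (2 / T) + V ^ 2 * (2 / T))) := by ring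
    rw [e]
    linarith
  have p3 : X * (1 + V) ^ 7 * Real.exp (-(T₀ / (4 * V)) ^ 2) ≤ V := by
    refine le_trans ?_ hEg
    refine mul_le_mul_of_nonneg_left (Real.exp_le_exp.2 ?_) (by positivity)
    rw [neg_le_neg_iff]
    have : T / (8 * V) ≤ T₀ / (4 * V) := by
      rw [div_le_div_iff₀ (by positivity) (by positivity)]
      calc T * (4 * V) ≤ (2 * T₀) * (4 * V) := mul_le_mul_of_nonneg_right (by linarith only [h1]) (by positivity)
        _ = T₀ * (8 * V) := by ring
    exact pow_le_pow_left₀ (by positivity) this 2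
  have htot : V * (1 + Real.log T₀ / Real.log X)
      + X * (T₀ ^ (9 / 10 : ℝ) + X ^ (3 / 2 : ℝ) * Real.sqrt T₀ * (1 + Real.log T₀) ^ 2
          + Real.sqrt X * V ^ 2 / T₀ + X * V / Real.sqrt T₀
          + ε * V * (1 + Real.log T₀) + ε⁻¹ * (1 + V / Real.sqrt T₀ + V ^ 2 / T₀))
      + X * (1 + V) ^ 7 * Real.exp (-(T₀ / (4 * V)) ^ 2) + V ≤ 70 * V := by linarith only [p1, p2, p3]
  have e70 : 70 * C₅ * V = C₅ * (70 * V) := by ring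
  rw [e70]
  exact mul_le_mul_of_nonneg_left htot hC₅.le

/-! ### The near sum is `O(T)` -/

set_option maxHeartbeats 1000000 in
/-- **The density input, final form.** There are `c > 0` and `T₁` such that for `T ≥ T₁` and every
`τ ≤ (log T)/1200`:
`∑_{ρ : ζ(ρ)=0, 0 < γ ≤ 5T/2, γ > T/2} m(ρ) δ_ρ e^{τδ_ρ/4} ≤ c T`, `δ_ρ = |β − 1/2|`.
[cite: Titchmarsh1986, §9.26] -/
theorem nearSum_le_linear : ∃ c T₁ : ℝ, 0 < c ∧ ∀ T : ℝ, T₁ ≤ T → ∀ τ : ℝ, τ ≤ Real.log T / 1200 →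
    ∑ ρ ∈ (zetaZeroBox_finite 0 (5 * T / 2)).toFinset.filter (fun ρ => T / 2 < ρ.im),
      (riemannZetaZeroOrder ρ : ℝ) * (|ρ.re - 1 / 2| * Real.exp (τ * |ρ.re - 1 / 2| / 4)) ≤ c * T := by
  obtain ⟨C₅, t₅, hC₅, -, hhalf⟩ := meanSquare_zetaMollifierG_half_le
  obtain ⟨Cw, hCw0, hCw⟩ := exists_sum_le_of_abs_im_sub_le
  set KB := 70 * C₅ + 1 with hKB
  have hKB1 : 1 ≤ KB := by rw [hKB]; linarith
  refine ⟨6 * Cw + 4 * (4802 * Real.sqrt (44 * KB) + 1) + 1, max ((10 : ℝ) ^ (1000 : ℕ)) (4 * t₅), by positivity, ?_⟩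
  intro T hT τ hτ
  have h10 : (10 : ℝ) ^ (1000 : ℕ) ≤ T := le_trans (le_max_left _ _) hT
  have h4t : 4 * t₅ ≤ T := le_trans (le_max_right _ _) hT
  have ⟨hT1, hT0⟩ := one_le_of_threshold h10
  have hL := log_ge_of_threshold h10
  have hX := numX h10
  have hV := numV h10
  have hVT := numVT h10
  have hN0 := numN0 h10
  have hRnum := numR h10
  have hmeanU : ∀ T₀ : ℝ, T / 2 ≤ T₀ → T₀ ≤ 3 * T →
      ∫ y : ℝ, ‖zetaMollifierG (T ^ (1 / 60 : ℝ)) T₀ (T ^ (19 / 20 : ℝ)) ((1 / 2 : ℝ) + y * I)‖ ^ 2 ≤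
        KB * T ^ (19 / 20 : ℝ) := by
    intro T₀ h1 h2
    refine (meanSquare_half_uniform hC₅ hhalf h10 h4t h1 h2).trans ?_
    have : 0 ≤ T ^ (19 / 20 : ℝ) := by positivity
    rw [hKB]; linarith only [this]
  clear hT h10 hhalf
  have hX0 : 0 < T ^ (1 / 60 : ℝ) := by positivity
  have hV0 : 0 < T ^ (19 / 20 : ℝ) := by positivity
  have hlogX : Real.log (T ^ (1 / 60 : ℝ)) = Real.log T / 60 := by rw [Real.log_rpow hT0]; ring
  generalize hXdef : T ^ (1 / 60 : ℝ) = X at hX hN0 hRnum hmeanU hX0 hlogX ⊢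
  generalize hVdef : T ^ (19 / 20 : ℝ) = V at hV hVT hRnum hmeanU hV0 ⊢
  generalize hLg : Real.log T = Lg at hL hN0 hRnum hlogX hτ ⊢
  -- the ratio `r`
  have hr_le : Real.exp (1 / (4 * 1200)) * (25 / X) ^ (1 / (20 * Lg)) ≤ Real.exp (-(1 / 2400)) := by
    have h25 : (0 : ℝ) < 25 / X := by positivity
    rw [Real.rpow_def_of_pos h25, ← Real.exp_add]
    refine Real.exp_le_exp.2 ?_
    rw [Real.log_div (by norm_num) hX0.ne', hlogX]
    have hl25 := log_consts.1
    have hLpos : 0 < Lg := by linarith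
    have e : (Real.log 25 - Lg / 60) * (1 / (20 * Lg)) = Real.log 25 / (20 * Lg) - 1 / 1200 := by field_simp; ring
    rw [e]
    have : Real.log 25 / (20 * Lg) ≤ 1 / 10000 := by
      rw [div_le_div_iff₀ (by positivity) (by norm_num)]; nlinarith
    norm_num at this ⊢; linarith
  have hr1 : Real.exp (1 / (4 * 1200)) * (25 / X) ^ (1 / (20 * Lg)) < 1 :=
    lt_of_le_of_lt hr_le (by rw [Real.exp_lt_one_iff]; norm_num)
  have hinv : Real.exp (1 / (4 * 1200)) / (1 - Real.exp (1 / (4 * 1200)) * (25 / X) ^ (1 / (20 * Lg))) ≤ 2 * 2401 := by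
    -- `1/(1 − e^{−x}) ≤ 1 + 1/x` with `x = 1/2400`, and `e^{1/4800} ≤ 2`
    have hx : 1 - Real.exp (-(1 / 2400 : ℝ)) ≥ (1 / 2400) / (1 + 1 / 2400) := by
      have h1 := Real.add_one_le_exp (1 / 2400 : ℝ)
      have hpos : 0 < Real.exp (1 / 2400 : ℝ) := Real.exp_pos _
      rw [Real.exp_neg, ge_iff_le, div_le_iff₀ (by norm_num)]
      have : (Real.exp (1 / 2400 : ℝ))⁻¹ * (1 + 1 / 2400) ≤ 1 := by
        rw [inv_mul_le_iff₀ hpos]; linarith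
      nlinarith
    have hden : (1 / 2400 : ℝ) / (1 + 1 / 2400) ≤ 1 - Real.exp (1 / (4 * 1200)) * (25 / X) ^ (1 / (20 * Lg)) := by
      linarith
    have hdpos : (0 : ℝ) < (1 / 2400) / (1 + 1 / 2400) := by norm_num
    have he2 : Real.exp (1 / (4 * 1200)) ≤ 2 := by
      have h := Real.abs_exp_sub_one_le (x := 1 / (4 * 1200)) (by rw [abs_of_pos (by norm_num)]; norm_num)
      rw [abs_of_pos (by norm_num : (0:ℝ) < 1 / (4 * 1200))] at h
      have := (abs_le.1 h).2
      linarith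
    calc Real.exp (1 / (4 * 1200)) / (1 - Real.exp (1 / (4 * 1200)) * (25 / X) ^ (1 / (20 * Lg)))
        ≤ 2 / ((1 / 2400 : ℝ) / (1 + 1 / 2400)) :=
          div_le_div₀ (by norm_num) he2 hdpos hden
      _ = 2 * 2401 := by norm_num
  -- the finite set of near zeros
  set F := (zetaZeroBox_finite 0 (5 * T / 2)).toFinset.filter (fun ρ => T / 2 < ρ.im) with hF
  have hFmem : ∀ ρ ∈ F, riemannZeta ρ = 0 ∧ 0 < ρ.re ∧ ρ.re < 1 ∧ T / 2 < ρ.im ∧ ρ.im ≤ 5 * T / 2 := by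
    intro ρ hρ
    simp only [hF, Finset.mem_filter, Set.Finite.mem_toFinset, zetaZeroBox, Set.mem_setOf_eq] at hρ
    obtain ⟨⟨hz, -, -, him, h5⟩, hT2⟩ := hρ
    have hnt := ZetaZeros.riemannZetaNontrivialZeros.mem_of_im_ne_zero hz him.ne'
    exact ⟨hz, ZetaZeros.riemannZetaNontrivialZeros.re_pos hnt, ZetaZeros.riemannZetaNontrivialZeros.re_lt_one hnt, hT2, h5⟩
  -- apply the explicit bound
  have hmain := nearSum_le_explicit hCw (X := X) (T := T) (V := V) (B := KB * V) (Lg := Lg) (M'' := 1200) (τ := τ)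
    (by linarith) (by linarith) (by linarith) (by linarith) (by norm_num) (by linarith)
    (by nlinarith) hmeanU hr1 F hFmem
  refine hmain.trans ?_
  -- numerics of the right-hand side
  have hJ : (⌈2 * T / (V - 1)⌉₊ : ℝ) ≤ 3 * (T / V) := by
    have hV1 : 0 < V - 1 := by linarith
    have hceil := Nat.ceil_lt_add_one (show 0 ≤ 2 * T / (V - 1) by positivity)
    have hTV : T / V = T * V⁻¹ := div_eq_mul_inv _ _
    have h1 : 2 * T / (V - 1) ≤ (5 / 2) * (T / V) := by
      rw [div_le_iff₀ hV1, hTV]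
      have : T = T * V⁻¹ * V := by field_simp
      nlinarith [mul_pos hT0 (inv_pos.2 hV0)]
    have h2 : 1 ≤ (1 / 2) * (T / V) := by
      rw [hTV]
      have : T * V⁻¹ * V = T := by field_simp
      nlinarith [mul_pos hT0 (inv_pos.2 hV0)]
    linarith
  have he2 : Real.exp (1 / (4 * 1200)) ≤ 2 := by
    have h := Real.abs_exp_sub_one_le (x := 1 / (4 * 1200)) (by rw [abs_of_pos (by norm_num)]; norm_num)
    rw [abs_of_pos (by norm_num : (0:ℝ) < 1 / (4 * 1200))] at h
    have := (abs_le.1 h).2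
    linarith
  have hsqrt : Real.sqrt (44 * V * (KB * V)) = V * Real.sqrt (44 * KB) := by
    rw [show 44 * V * (KB * V) = (44 * KB) * V ^ 2 by ring, Real.sqrt_mul (by positivity), Real.sqrt_sq hV0.le, mul_comm]
  rw [hsqrt]
  -- term 1
  have hlogpos : 0 ≤ Real.log (5 * T / 2 + 3) := Real.log_nonneg (by linarith)
  have t1 : Real.exp (1 / (4 * 1200)) * (Cw * ((2 * T + 3) * Real.log (5 * T / 2 + 3))) / Lg ≤ 6 * Cw * T := by
    have hLpos : 0 < Lg := by linarith
    rw [div_le_iff₀ hLpos]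
    have h0 : 0 ≤ Cw * ((2 * T + 3) * Real.log (5 * T / 2 + 3)) := by positivity
    calc Real.exp (1 / (4 * 1200)) * (Cw * ((2 * T + 3) * Real.log (5 * T / 2 + 3)))
        ≤ 2 * (Cw * ((2 * T + 3) * Real.log (5 * T / 2 + 3))) := mul_le_mul_of_nonneg_right he2 h0
      _ ≤ 2 * (Cw * (3 * T * Lg)) :=
          mul_le_mul_of_nonneg_left (mul_le_mul_of_nonneg_left hN0 hCw0.le) (by norm_num)
      _ = 6 * Cw * T * Lg := by ring
  -- term 2
  set Rr := 8 * V * X ^ (-(1 / 2 : ℝ)) + 5 * (π * (15 * (Real.log 10 + 4 * Real.log (3 * T + 13) + Real.log X) + 1)) + 5 / 2 * π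
    with hRr
  have hRle : Rr * (Lg * Real.exp (((⌊Lg / 2⌋₊ : ℝ) + 1) / (4 * 1200))) ≤ V := hRnum
  have hinner : V * Real.sqrt (44 * KB) * (Real.exp (1 / (4 * 1200)) / (1 - Real.exp (1 / (4 * 1200)) * (25 / X) ^ (1 / (20 * Lg)))) +
      Rr * (Lg * Real.exp (((⌊Lg / 2⌋₊ : ℝ) + 1) / (4 * 1200))) ≤ V * (4802 * Real.sqrt (44 * KB) + 1) := by
    have h0 : 0 ≤ V * Real.sqrt (44 * KB) := by positivity
    have := mul_le_mul_of_nonneg_left hinv h0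
    nlinarith
  have hJπ : 4 * (⌈2 * T / (V - 1)⌉₊ : ℝ) / π ≤ 4 * T / V := by
    have hπ3 : (3 : ℝ) ≤ π := by linarith [Real.pi_gt_three]
    rw [div_le_iff₀ Real.pi_pos]
    have e : 4 * T / V = 4 * (T / V) := by ring
    rw [e]
    have hTV0 : 0 ≤ T / V := by positivity
    nlinarith [mul_le_mul hJ hπ3 (by norm_num) (by positivity)]
  have hinner0 : 0 ≤ V * Real.sqrt (44 * KB) * (Real.exp (1 / (4 * 1200)) / (1 - Real.exp (1 / (4 * 1200)) * (25 / X) ^ (1 / (20 * Lg)))) +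
      Rr * (Lg * Real.exp (((⌊Lg / 2⌋₊ : ℝ) + 1) / (4 * 1200))) := by
    have h1r : 0 < 1 - Real.exp (1 / (4 * 1200)) * (25 / X) ^ (1 / (20 * Lg)) := by linarith
    have hR0 : 0 ≤ Rr := by
      rw [hRr]
      have : 0 ≤ Real.log (3 * T + 13) := Real.log_nonneg (by linarith)
      have : 0 ≤ Real.log 10 := Real.log_nonneg (by norm_num)
      have : 0 ≤ Real.log X := Real.log_nonneg (by linarith)
      positivity
    positivity
  have t2 : 4 * (⌈2 * T / (V - 1)⌉₊ : ℝ) / π *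
      (V * Real.sqrt (44 * KB) * (Real.exp (1 / (4 * 1200)) / (1 - Real.exp (1 / (4 * 1200)) * (25 / X) ^ (1 / (20 * Lg)))) +
        Rr * (Lg * Real.exp (((⌊Lg / 2⌋₊ : ℝ) + 1) / (4 * 1200)))) ≤ 4 * (4802 * Real.sqrt (44 * KB) + 1) * T := by
    calc _ ≤ (4 * T / V) * (V * (4802 * Real.sqrt (44 * KB) + 1)) := mul_le_mul hJπ hinner hinner0 (by positivity)
      _ = 4 * (4802 * Real.sqrt (44 * KB) + 1) * T := by field_simp
  have hsum := add_le_add t1 t2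
  refine hsum.trans ?_
  have : 0 ≤ T := hT0.le
  nlinarith only [this]

end Literature.NumberTheory.LFunctions.SelbergDelta
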